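import Mathlib
import Summits.Ventures.HodgeRepro2.Tier7.Target
import Summits.Ventures.HodgeRepro2.Tier7.Line3.Defs
import Summits.Ventures.HodgeRepro2.Tier7.Line3.Shadow
import Summits.Ventures.HodgeRepro2.T7SupportDominantGeometricSide

/-!
# Tier7/Line3/RealDominant — the VERSION-(ii) obligation shape of Line 3 in the kernel
(`RealDominant D ↔ RtfConclusion D` on every datum — NOT a stronger residual; the content is in the fields)

Line 3 of record (L3-ARGUMENT.md §2e, t7-plan-3 l. 14964 / l. 15017: «VERSION (ii) IS THE LINE») takes INTEGRABLE
matrix coefficients of the holomorphic discrete series as the archimedean test functions at `ι₂, ι₃`, so the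
geometric side of the two-torus relative trace formula is an INFINITE absolutely convergent sum over the double
cosets `T_A(F)\U(W_A)(F)/T_B(F)` with ONE DOMINANT TERM `γ₀` at deep level `N`. Its typed shadow is seat p1's
`DominantSide Rep Orb PA PB` (T7SupportDominantGeometricSide, p667026): `orb N γ = a γ * b N γ`, `abs_summable`,
`identity`, the analytic fields `a_bound` (decay exponent `α`), `count_bound` (growth exponent `β`), `b_bound`
(growth exponent `d'`), `hαβ : β + d' < α`, `size_of_arith` (size threshold `ρ N → ∞`), and the dominant term
`a_γ₀ ≠ 0`, `b_γ₀ ≠ 0`; its chain `DominantSide.exists_twoTorus : ∃ π, PA π ∧ PB π` is sorry-free.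

This module is the `DominantSide` twin of `Shadow.lean`'s `RealShadowData` (t7-plan-3, p666683/p666781): the SAME
seesaw carriers and seesaw fields (`SeesawData D`: spectrum `Rep`, theta lifts `Θ`, isotypic projections `comp`;
the period predicates `perA`, `perB`; the seesaw identities `seesawA`, `seesawB` — Kudla 1984 + Howe duality, as iffs;
`Θ_ne_bot_of_perA` — GQT Thm 1.4(ii) + Sun–Zhu/Moen), with `sh : DominantSide Rep Orb perA perB` in place of the
compact-support shape `RtfShadow`. So the line of record gets its kernel chain
  `RealDominant D → RtfConclusion D → ∃ g, D.S.L2 (D.fOmegaS g) (D.fOmegaSbar g) ≠ 0`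
with the residual fields of memo §2e displayed BY NAME:
* (a′) DOMINANCE — for the real double cosets: `size_of_arith` (the size threshold: product-formula separation,
  x1 ProductFormulaSeparation p666471 + KappaCongruence p667644 + KappaBound p668728 + KappaDefiniteBound p666869 at
  the model level), `count_bound` (x1 LatticeBoxCount p667317 / NumberFieldBoxCount p668054, p5 LatticeCount p667606 /
  NumberFieldHyperbolicCount p670521 / CountBoundOfKappa p671204), `a_bound` (the `D_k` coefficient decay, p1's
  T5Bergman rows / BergmanOrbitalDecay p668355), `b_bound` (x1 SplitOrbitBox p670387 + the divisor bound — L1-p3 g3's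
  DivisorBound target, l. 15059), `hαβ` (p1 ExponentGlue p667520), `abs_summable` (p5 AbsSummable p668020);
* (b′) NON-VANISHING — `a_γ₀` (the archimedean matrix coefficients at a regular rational `γ₀`: p1 BergmanRegularPoint
  p669500 + DenseRegularPoint p670104 in the model) and `b_γ₀` (the finite factors at every level: volumes `> 0`,
  p1 LocalFactorPositive p664522, SplitOrbit rows 667–669);
* `identity` — Getz–Hahn 2024 GTM 300 Cor. 18.3.1 p.371 on the two kernels of the finite-rank operator `R(f)`
  (memo §2e: x1 KernelUniqueness p669387, p1 KernelUnique p669775 / FiniteRankSelfAdjoint p670744).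
NOTHING here proves any of these fields for the real objects: `X`, `U(W_A)`, the tori and the test functions are not
typed (TYPING-CENSUS T7). AS A PROP `RealDominant D` IS EQUIVALENT TO `RtfConclusion D` ON EVERY DATUM
(`realDominant_iff_rtfConclusion` below; the converse is the one-point shadow `DominantSide.trivial`, the exact
analogue of crit-1's `RtfShadow.trivial`): the carriers are existentially bound and the type does not tie them to the
real objects — the obligation shape, not the residual. The residual stays in WORDS: (a′)/(b′) for the real seesaw data
of `X` (the lead's l. 14881 (4) as amended by plan-3 l. 14964).

Blind lane: Mathlib + the HodgeRepro2 prefix only; no sorry; axioms ⊆ {propext, Classical.choice, Quot.sound}.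
§8(d): NO — glue and a one-point instance; no non-vanishing device of any kind.
-/

namespace Summit.Ventures.HodgeRepro2.Tier7

open Summit.Ventures.HodgeRepro2.T6
open Summit.Ventures.HodgeRepro2.T7SupportDominantGeometricSide

noncomputable section

namespace Line3

/-! ## 1. The one-point dominant-side shadow (the analogue of `RtfShadow.trivial`) -/

open Classical in
/-- the trivial dominant-side shadow: one label `π₀` carries the whole spectral side, one double coset (`Unit`)
the whole geometric side, every analytic field holds with the constants `1` (size `0`, `α = 1`, `β = d' = 0`,
threshold `ρ N = N`). It is the exact analogue of crit-1's `RtfShadow.trivial` (Shadow.lean): the version-(ii)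
shape, too, is inhabited as soon as one label has both periods. -/
def DominantSide.trivial {Rep : Type} {PA PB : Rep → Prop} (π₀ : Rep) (hA : PA π₀) (hB : PB π₀) :
    DominantSide Rep Unit PA PB where
  spec := fun _ π => if π = π₀ then (1 : ℂ) else 0
  spec_zero_A := fun _ π h => by
    by_cases hπ : π = π₀
    · subst hπ; exact absurd hA h
    · simp [hπ]
  spec_zero_B := fun _ π h => by
    by_cases hπ : π = π₀
    · subst hπ; exact absurd hB h
    · simp [hπ]
  a := fun _ => 1
  b := fun _ _ => 1
  orb := fun _ _ => 1
  orb_eq := fun _ _ => by simp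
  abs_summable := fun _ => Summable.of_finite
  identity := fun _ => by simp [tsum_fintype, tsum_ite_eq]
  γ₀ := ()
  size := fun _ => 0
  size_nonneg := fun _ => le_rfl
  arith := fun _ _ => True
  b_support := fun _ _ _ => True.intro
  α := 1
  β := 0
  d' := 0
  hβ := le_rfl
  hd' := le_rfl
  hαβ := by norm_num
  a_bound := ⟨1, fun _ => by simp⟩
  ρ := fun N => (N : ℝ)
  hρ := tendsto_natCast_atTop_atTop
  size_of_arith := fun _ γ _ h => absurd (Subsingleton.elim γ ()) h
  count_bound := ⟨1, fun _ R _ => ⟨{()}, fun γ _ _ => Finset.mem_singleton.2 (Subsingleton.elim γ ()),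
    by simp⟩⟩
  b_bound := ⟨1, fun _ _ _ => by simp⟩
  a_γ₀ := one_ne_zero
  b_γ₀ := ⟨0, fun _ _ => one_ne_zero⟩

/-! ## 2. The version-(ii) obligation shape over the datum's seesaw carriers -/

variable {K : Type} [Field K] [NumberField K] {E' : Type} [Field E'] [NumberField E']
  {V : Type} [AddCommGroup V] [Module E' V] {HX : Type} [Ring HX] [Algebra ℂ HX]
  {G : Type} [Group G] [MulAction G HX]
variable (D : PeriodDatum K E' V HX G)

/-- The version-(ii) obligation shape: the seesaw data of the datum (`SeesawData D` — F1/F2), two period predicates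
with the seesaw identities (F3, Kudla 1984 + Howe duality, as iffs), the theta non-vanishing of a `π` with the A-period
(F4/F5), and a DOMINANT-SIDE shadow (p1's `DominantSide`: infinite absolutely convergent geometric side with one
dominant term) over these carriers — the fields of L3-ARGUMENT.md §2e (a′)/(b′) by name. The carriers are
existentially bound in `RealDominant`; the type does not tie them to the real objects
(`realDominant_iff_rtfConclusion`). Same seesaw fields as `RealShadowData` (Shadow.lean), `sh` re-typed. -/
structure RealDominantData extends SeesawData D where
  /-- the `(T_A, μ_A)`-period of `π` is non-zero (a predicate; no value stated). -/
  perA : Rep → Prop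
  /-- the `(T_B, μ_B)`-period of `π` is non-zero. -/
  perB : Rep → Prop
  /-- seesaw (Kudla 1984) + Howe duality: the `Θ π`-component of some A-product translate is non-zero iff the
  `(T_A, μ_A)`-period of `π` is non-zero and `Θ π ≠ ⊥`. -/
  seesawA : ∀ π, (∃ g : Fin 4 → G, comp π (D.fOmegaS g) ≠ 0) ↔ (perA π ∧ Θ π ≠ ⊥)
  /-- the same for the B-product. -/
  seesawB : ∀ π, (∃ g : Fin 4 → G, comp π (D.fOmegaSbar g) ≠ 0) ↔ (perB π ∧ Θ π ≠ ⊥)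
  /-- a `π` with non-zero `(T_A, μ_A)`-period has a non-zero theta lift (GQT Thm 1.4(ii) + Sun–Zhu/Moen, F4/F5). -/
  Θ_ne_bot_of_perA : ∀ π, perA π → Θ π ≠ ⊥
  /-- the double cosets `T_A(F)\U(W_A)(F)/T_B(F)`. -/
  Orb : Type
  /-- decidable equality of double cosets (a parameter of p1's `DominantSide`; classical on the real carriers). -/
  [decEq : DecidableEq Orb]
  /-- the two-torus RTF in its version-(ii) (dominant-term) form over the datum's spectrum and periods:
  `spec`/`orb` = the two sides of Getz–Hahn Cor. 18.3.1 for the integrable archimedean test functions,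
  `size` = the archimedean invariant `κ`, `arith N γ` = «`γ` meets the level-`N` support». -/
  sh : DominantSide Rep Orb perA perB

/-- The version-(ii) obligation shape as a Prop — EQUIVALENT to `RtfConclusion D` on every datum
(`realDominant_iff_rtfConclusion`). -/
def RealDominant : Prop := Nonempty (RealDominantData D)

/-- `RealDominant D → RtfConclusion D` (sorry-free): the dominant-term two-torus conclusion
(`DominantSide.exists_twoTorus`) plus the seesaw identities. -/
theorem rtfConclusion_of_realDominant (h : RealDominant D) : RtfConclusion D := by
  obtain ⟨R⟩ := h
  letI := R.decEq
  obtain ⟨π, hA, hB⟩ := R.sh.exists_twoTorus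
  have hΘ : R.Θ π ≠ ⊥ := R.Θ_ne_bot_of_perA π hA
  exact ⟨R.toSeesawData, π, (R.seesawA π).2 ⟨hA, hΘ⟩, (R.seesawB π).2 ⟨hB, hΘ⟩⟩

/-- **THE CHAIN** `RealDominant D → ∃ g, L2 (fOmegaS g) (fOmegaSbar g) ≠ 0` (sorry-free, uniform in `D`), through
the landed per-datum bridge `exists_translates_of` (Defs.lean, p661163). -/
theorem exists_translates_of_realDominant (h : RealDominant D) :
    ∃ g : Fin 4 → G, D.S.L2 (D.fOmegaS g) (D.fOmegaSbar g) ≠ 0 :=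
  exists_translates_of D (rtfConclusion_of_realDominant D h)

/-- clause (i) of the per-datum test, generically: a datum without `RtfConclusion` has no dominant-side shape. -/
theorem not_realDominant_of_not_rtfConclusion (h : ¬ RtfConclusion D) : ¬ RealDominant D :=
  fun hr => h (rtfConclusion_of_realDominant D hr)

/-- **THE CONVERSE**: `RtfConclusion D → RealDominant D` on every datum: `perA`/`perB` are DEFINED as the left-hand
sides of the seesaw iffs and the shadow is the one-point `DominantSide.trivial` (the construction of crit-1's
`realShadow_of_rtfConclusion`, re-read for version (ii)). -/
theorem realDominant_of_rtfConclusion (h : RtfConclusion D) : RealDominant D := by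
  obtain ⟨sw, π₀, hA, hB⟩ := h
  exact ⟨{ toSeesawData := sw
           perA := fun π => ∃ g : Fin 4 → G, sw.comp π (D.fOmegaS g) ≠ 0
           perB := fun π => ∃ g : Fin 4 → G, sw.comp π (D.fOmegaSbar g) ≠ 0
           seesawA := fun π => ⟨fun h => ⟨h, by obtain ⟨g, hg⟩ := h; exact sw.Θ_ne_bot_of_comp_ne_zero D π _ hg⟩,
             fun h => h.1⟩
           seesawB := fun π => ⟨fun h => ⟨h, by obtain ⟨g, hg⟩ := h; exact sw.Θ_ne_bot_of_comp_ne_zero D π _ hg⟩,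
             fun h => h.1⟩
           Θ_ne_bot_of_perA := fun π h => by obtain ⟨g, hg⟩ := h; exact sw.Θ_ne_bot_of_comp_ne_zero D π _ hg
           Orb := Unit
           decEq := inferInstance
           sh := DominantSide.trivial π₀ hA hB }⟩

/-- `RealDominant D ↔ RtfConclusion D` — the version-(ii) obligation shape is the same Prop as Line 3's conclusion,
on every datum (as `realShadow_iff_rtfConclusion` for the compact-support shape). -/
theorem realDominant_iff_rtfConclusion : RealDominant D ↔ RtfConclusion D :=
  ⟨rtfConclusion_of_realDominant D, realDominant_of_rtfConclusion D⟩

/-- the two obligation shapes of Line 3 (compact-support `RealShadow`, dominant-term `RealDominant`) are the same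
Prop on every datum — the choice between versions (i) and (ii) of the test functions is a choice of which FIELDS
carry the residual, not of the residual's strength. -/
theorem realDominant_iff_realShadow : RealDominant D ↔ RealShadow D :=
  (realDominant_iff_rtfConclusion D).trans (realShadow_iff_rtfConclusion D).symm

/-- any `RealDominantData` yields a `RealShadowData` with the SAME seesaw data and period predicates (the
one-point `RtfShadow` over a label the dominant side produces) — the seesaw interface is shared, only the RTF
shape differs. -/
def RealDominantData.toRealShadowData (R : RealDominantData D) : RealShadowData D :=
  letI := R.decEq
  { toSeesawData := R.toSeesawData
    perA := R.perA
    perB := R.perB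
    seesawA := R.seesawA
    seesawB := R.seesawB
    Θ_ne_bot_of_perA := R.Θ_ne_bot_of_perA
    Orb := Unit
    sh := RtfShadow.trivial (Classical.choose R.sh.exists_twoTorus)
      (Classical.choose_spec R.sh.exists_twoTorus).1 (Classical.choose_spec R.sh.exists_twoTorus).2 }

/-- the seesaw data are carried over unchanged. -/
theorem RealDominantData.toRealShadowData_toSeesawData (R : RealDominantData D) :
    R.toRealShadowData.toSeesawData = R.toSeesawData := rfl

/-- the A-period predicate is carried over unchanged. -/
theorem RealDominantData.toRealShadowData_perA (R : RealDominantData D) :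
    R.toRealShadowData.perA = R.perA := rfl

/-- the B-period predicate is carried over unchanged. -/
theorem RealDominantData.toRealShadowData_perB (R : RealDominantData D) :
    R.toRealShadowData.perB = R.perB := rfl

end Line3

end

end Summit.Ventures.HodgeRepro2.Tier7
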